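import Summits.Ventures.LatticeQCDFlow.Scaling.SwapAcceptanceLadder
import Summits.Ventures.LatticeQCDFlow.Scaling.DefectVarianceFloor

/-!
HONEST FRAMING: exact (Metropolis-corrected) sampling algorithms for lattice gauge theory; figures
of merit are autocorrelation/cost numbers at stated couplings and volumes; no continuum-physics
claim.

# DefectSwapAcceptance — TEMPERING IN THE BOUNDARY CONDITION (PTBC): THE SWAP ACCEPTANCE BETWEEN DEFECT
# COUPLINGS `u < u'` AT BULK COUPLING `β` IS AT MOST `exp(−e^{−8N(d−1)B}·#D·v_ρ·(u'−u)²/(4(8d(d−1)+1)))`,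
# SO A PTBC LADDER WITH ADJACENT SWAP RATES `≥ α` NEEDS `Ω(√#D)` REPLICAS AND `O(#D)` ALWAYS SUFFICE —
# EVERY COMPACT GAUGE GROUP, EVERY BULK COUPLING, EVERY VOLUME (lean-2 GEN-11, ours)

Venture-side (OURS).  Cell `lqcd-flow` (pub-lqcd), unit `pub-lqcd-lean-2-g11`, 2026-08-23.  The defect
docking of `Scaling/SwapAcceptanceLaw` / `SwapAcceptanceLadder`: for a finite set `D` of plaquettes, the
defect action `S_D(U) = Σ_{p∈D} (N − Re tr ρ(U_p))`, the bulk action `S_{Dᶜ}`, and the two-coupling family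
`μ_{β,u} ∝ exp(−β S_{Dᶜ} − u S_D) dU` of theory2 item 132 / lean-1's `Scaling/DefectVarianceFloor` (the
measures between which the boundary-condition-tempering samplers — Hasenbusch 2017; Bonanno–Bonati–D'Elia
2021 (PTBC) — swap; `u = 0` open defect, `u = β` periodic).  At fixed `β` this is the exponential family
`ν_β.tilted(u·X)` with base `ν_β = dU.tilted(−β S_{Dᶜ})` and `X = −S_D` (`defect_family_eq`), so the
abstract law applies verbatim:

* §1 dictionary: `S_D` continuous, `0 ≤ S_D ≤ 2N·#D`, `ν_β` a probability measure, `defect_family_eq`;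
  `defect_swapAcc_eq` — `swapAcc (−S_D) ν_β u u' = ∫∫ min(1, e^{(u'−u)(S_D(V) − S_D(U))}) dμ_{β,u}(U) dμ_{β,u'}(V)`,
  the stationary mean acceptance of the PTBC swap between the replicas at defect couplings `u`, `u'`
  (`Exactness/PTBCSwap.lean`: the swap is exact).
* §2 **`defect_swapAcc_le`** (`L ≥ 2`, `|β|, |u|, |u'| ≤ B`, `u ≤ u'`):
  `swapAcc ≤ exp(−e^{−8N(d−1)B}·(#D/(8d(d−1)+1))·Var_Haar(Re tr ρ)·(u'−u)²/4)` — lean-1's defect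
  specific-heat floor (DVF) `Theory2.DefectFloor.defect_variance_floor` in the abstract floor form; and the
  trivial ceiling `Var(S_D) ≤ (N#D)²` gives `swapAcc ≥ exp(−((u'−u)·√2·N#D + (N#D)²(u'−u)²))`
  (`defect_swapAcc_ge`).
* §3 **PTBC LADDER LAW**: `defect_ladder_necessary` — a monotone defect-coupling ladder `c_0 ≤ … ≤ c_K` inside
  `[−B, B]` (`|β| ≤ B`) with all adjacent swap rates `≥ α > 0` satisfies
  `e^{−8N(d−1)B}·(#D/(8d(d−1)+1))·Var_Haar(Re tr ρ)·(c_K − c_0)² ≤ 4K²·log(1/α)`: **`K = Ω((c_K − c_0)·√#D)`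
  replicas are NECESSARY** for every compact `G` with `Var_Haar(Re tr ρ) > 0`, every bulk `β`, uniformly in
  `L`; `defect_ladder_sufficient` — `⌈(c_K − c_0)·N·#D·max(1, 3/log(1/α))⌉` uniform replicas always SUFFICE.

Literature grade (cell rule): KNOWN MECHANISM (replica spacing `∝ 1/√Var` of the tempered energy term;
Hukushima–Nemoto 1996, Kofke 2002, Predescu et al. 2004), NEW DOCKING (the defect family of the
boundary-condition-tempering samplers, every compact gauge group); nothing cited as a fact.  NOT CLAIMED:
the sharp `#D`-dependence between `√#D` and `#D` (a defect specific-heat CEILING of order `#D` is not in the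
tree); the decay `e^{−8N(d−1)B}` is the domination artefact of (DVF), structural only; round-trip times;
anything numerical about the published PTBC runs.
-/

noncomputable section

open MeasureTheory ProbabilityTheory Real Set
open Literature.MathematicalPhysics.QuantumFieldTheory
open Summit.Ventures.LatticeQCDFlow.Theory2.ExtensiveSpecificHeat (integrable_of_continuous_config)

namespace Summit.Ventures.LatticeQCDFlow.Scaling

section Defect

variable {d L N : ℕ} [NeZero L] {G : Type*} [Group G] [TopologicalSpace G] [IsTopologicalGroup G]
  [CompactSpace G] [MeasurableSpace G] [BorelSpace G] [SecondCountableTopology G]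
  (ρ : G →* Matrix (Fin N) (Fin N) ℂ)

/-! ## §1 Dictionary: the defect action, the base measure, the family, the reading -/

omit [NeZero L] [CompactSpace G] [MeasurableSpace G] [BorelSpace G] [SecondCountableTopology G] in
/-- The action `Σ_{p∈D} (N − Re tr ρ(U_p))` of a set `D` of plaquettes is continuous. [folklore] -/
theorem continuous_defectSum (hρ : Continuous ρ) (D : Finset (Plaquette d L)) :
    Continuous fun U : GaugeConfig d L G =>
      ∑ p ∈ D, ((N : ℝ) - (ρ (plaquetteHolonomy U p.1 p.2.1.1 p.2.1.2)).trace.re) := by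
  refine continuous_finsetSum _ fun p _ => continuous_const.sub ?_
  have h1 : Continuous fun U : GaugeConfig d L G => plaquetteHolonomy U p.1 p.2.1.1 p.2.1.2 := by
    unfold plaquetteHolonomy; fun_prop
  exact Complex.continuous_re.comp (hρ.comp h1).matrix_trace

omit [NeZero L] [MeasurableSpace G] [BorelSpace G] [SecondCountableTopology G] in
/-- `0 ≤ Σ_{p∈D} (N − Re tr ρ(U_p)) ≤ 2N·#D`. [folklore] -/
theorem defectSum_mem_Icc (hρ : Continuous ρ) (D : Finset (Plaquette d L)) (U : GaugeConfig d L G) :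
    (∑ p ∈ D, ((N : ℝ) - (ρ (plaquetteHolonomy U p.1 p.2.1.1 p.2.1.2)).trace.re)) ∈
      Icc (0 : ℝ) (2 * N * D.card) := by
  have hb : ∀ p ∈ D, |(ρ (plaquetteHolonomy U p.1 p.2.1.1 p.2.1.2)).trace.re| ≤ N :=
    fun p _ => WilsonRP.abs_plaqRe_le ρ hρ U p
  constructor
  · exact Finset.sum_nonneg fun p hp => by linarith [(abs_le.1 (hb p hp)).2]
  · calc (∑ p ∈ D, ((N : ℝ) - (ρ (plaquetteHolonomy U p.1 p.2.1.1 p.2.1.2)).trace.re))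
        ≤ ∑ _p ∈ D, (2 * N : ℝ) :=
          Finset.sum_le_sum fun p hp => by linarith [(abs_le.1 (hb p hp)).1]
      _ = 2 * N * D.card := by rw [Finset.sum_const, nsmul_eq_mul]; ring

omit [NeZero L] [MeasurableSpace G] [BorelSpace G] [SecondCountableTopology G] in
/-- `|−S_D| ≤ 2N·#D`. [folklore] -/
theorem neg_defectSum_bounded (hρ : Continuous ρ) (D : Finset (Plaquette d L)) :
    ∃ C : ℝ, ∀ U : GaugeConfig d L G,
      |(-(∑ p ∈ D, ((N : ℝ) - (ρ (plaquetteHolonomy U p.1 p.2.1.1 p.2.1.2)).trace.re)))| ≤ C :=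
  ⟨2 * N * D.card, fun U => by
    rw [abs_neg, abs_of_nonneg (defectSum_mem_Icc ρ hρ D U).1]
    exact (defectSum_mem_Icc ρ hρ D U).2⟩

omit [CompactSpace G] in
/-- `−S_D` is measurable. [folklore] -/
theorem measurable_neg_defectSum (hρ : Continuous ρ) (D : Finset (Plaquette d L)) :
    Measurable fun U : GaugeConfig d L G =>
      -(∑ p ∈ D, ((N : ℝ) - (ρ (plaquetteHolonomy U p.1 p.2.1.1 p.2.1.2)).trace.re)) :=
  (continuous_defectSum ρ hρ D).fun_neg.measurable

/-- `exp(−β S_{Dᶜ})` is integrable for product Haar. [folklore] -/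
theorem integrable_exp_neg_bulk (hρ : Continuous ρ) (β : ℝ) (D : Finset (Plaquette d L)) :
    Integrable (fun U : GaugeConfig d L G =>
        Real.exp (-(β * ∑ p ∈ Dᶜ, ((N : ℝ) - (ρ (plaquetteHolonomy U p.1 p.2.1.1 p.2.1.2)).trace.re))))
      (Measure.pi fun _ : Edge d L => haarProbability G) :=
  integrable_of_continuous_config
    (Real.continuous_exp.comp ((continuous_const.mul (continuous_defectSum ρ hρ Dᶜ)).fun_neg))

/-- The base measure `ν_β = dU.tilted(−β S_{Dᶜ})` is a probability measure. [folklore] -/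
theorem isProbabilityMeasure_defectBase (hρ : Continuous ρ) (β : ℝ) (D : Finset (Plaquette d L)) :
    IsProbabilityMeasure ((Measure.pi fun _ : Edge d L => haarProbability G).tilted fun U =>
      -(β * ∑ p ∈ Dᶜ, ((N : ℝ) - (ρ (plaquetteHolonomy U p.1 p.2.1.1 p.2.1.2)).trace.re))) :=
  isProbabilityMeasure_tilted (integrable_exp_neg_bulk ρ hρ β D)

/-- **The defect family is an exponential family in the defect coupling**:
`ν_β.tilted(u·(−S_D)) = dU.tilted(−(β S_{Dᶜ} + u S_D)) = μ_{β,u}` (item 132's `defectFamily`, lean-1's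
spelling). [folklore] -/
theorem defect_family_eq (hρ : Continuous ρ) (β u : ℝ) (D : Finset (Plaquette d L)) :
    (((Measure.pi fun _ : Edge d L => haarProbability G).tilted fun U =>
        -(β * ∑ p ∈ Dᶜ, ((N : ℝ) - (ρ (plaquetteHolonomy U p.1 p.2.1.1 p.2.1.2)).trace.re))).tilted
      fun U => u * (-(∑ p ∈ D, ((N : ℝ) - (ρ (plaquetteHolonomy U p.1 p.2.1.1 p.2.1.2)).trace.re)))) =
    (Measure.pi fun _ : Edge d L => haarProbability G).tilted fun U =>
      -(β * (∑ p ∈ Dᶜ, ((N : ℝ) - (ρ (plaquetteHolonomy U p.1 p.2.1.1 p.2.1.2)).trace.re))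
        + u * (∑ p ∈ D, ((N : ℝ) - (ρ (plaquetteHolonomy U p.1 p.2.1.1 p.2.1.2)).trace.re))) := by
  rw [tilted_tilted (integrable_exp_neg_bulk ρ hρ β D)]
  congr 1
  funext U
  simp only [Pi.add_apply]
  ring

/-- **READING (PTBC)**: `swapAcc (−S_D) ν_β u u' = ∫∫ min(1, e^{(u'−u)(S_D(V) − S_D(U))}) dμ_{β,u}(U) dμ_{β,u'}(V)`
— the stationary mean acceptance of the boundary-condition-tempering swap between the replicas at defect
couplings `u` and `u'` (bulk coupling `β`). [ours] -/
theorem defect_swapAcc_eq (hρ : Continuous ρ) (β u u' : ℝ) (D : Finset (Plaquette d L)) :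
    swapAcc (fun U : GaugeConfig d L G =>
        -(∑ p ∈ D, ((N : ℝ) - (ρ (plaquetteHolonomy U p.1 p.2.1.1 p.2.1.2)).trace.re)))
      ((Measure.pi fun _ : Edge d L => haarProbability G).tilted fun U =>
        -(β * ∑ p ∈ Dᶜ, ((N : ℝ) - (ρ (plaquetteHolonomy U p.1 p.2.1.1 p.2.1.2)).trace.re))) u u' =
    ∫ q, min 1 (exp ((u' - u) *
        ((∑ p ∈ D, ((N : ℝ) - (ρ (plaquetteHolonomy q.2 p.1 p.2.1.1 p.2.1.2)).trace.re)) -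
          ∑ p ∈ D, ((N : ℝ) - (ρ (plaquetteHolonomy q.1 p.1 p.2.1.1 p.2.1.2)).trace.re))))
      ∂(((Measure.pi fun _ : Edge d L => haarProbability G).tilted fun U =>
          -(β * (∑ p ∈ Dᶜ, ((N : ℝ) - (ρ (plaquetteHolonomy U p.1 p.2.1.1 p.2.1.2)).trace.re))
            + u * (∑ p ∈ D, ((N : ℝ) - (ρ (plaquetteHolonomy U p.1 p.2.1.1 p.2.1.2)).trace.re)))).prod
        ((Measure.pi fun _ : Edge d L => haarProbability G).tilted fun U =>
          -(β * (∑ p ∈ Dᶜ, ((N : ℝ) - (ρ (plaquetteHolonomy U p.1 p.2.1.1 p.2.1.2)).trace.re))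
            + u' * (∑ p ∈ D, ((N : ℝ) - (ρ (plaquetteHolonomy U p.1 p.2.1.1 p.2.1.2)).trace.re))))) := by
  unfold swapAcc
  rw [defect_family_eq ρ hρ β u D, defect_family_eq ρ hρ β u' D]
  refine integral_congr_ae (ae_of_all _ fun q => ?_)
  simp only
  ring_nf

/-- **(DVF) in the family spelling**: for `L ≥ 2`, `|β|, |v| ≤ B`:
`e^{−8N(d−1)B}·(#D/(8d(d−1)+1))·Var_Haar(Re tr ρ) ≤ Var[−S_D ; ν_β.tilted(v·(−S_D))]` (lean-1's
`Theory2.DefectFloor.defect_variance_floor` transported along `defect_family_eq`). [ours] -/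
theorem defect_floor_family (hL : 2 ≤ L) (hρ : Continuous ρ) {β v B : ℝ} (hβ : |β| ≤ B) (hv : |v| ≤ B)
    (D : Finset (Plaquette d L)) :
    Real.exp (-(8 * N * ((d - 1 : ℕ) : ℝ) * B)) * ((D.card : ℝ) / ((8 * d * (d - 1) + 1 : ℕ) : ℝ))
        * variance (fun g : G => (ρ g).trace.re) (haarProbability G) ≤
      variance (fun U : GaugeConfig d L G =>
          -(∑ p ∈ D, ((N : ℝ) - (ρ (plaquetteHolonomy U p.1 p.2.1.1 p.2.1.2)).trace.re)))
        ((((Measure.pi fun _ : Edge d L => haarProbability G).tilted fun U =>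
          -(β * ∑ p ∈ Dᶜ, ((N : ℝ) - (ρ (plaquetteHolonomy U p.1 p.2.1.1 p.2.1.2)).trace.re))).tilted
          fun U => v * (-(∑ p ∈ D, ((N : ℝ) - (ρ (plaquetteHolonomy U p.1 p.2.1.1 p.2.1.2)).trace.re))))) := by
  rw [defect_family_eq ρ hρ β v D, variance_fun_neg]
  exact Theory2.DefectFloor.defect_variance_floor (d := d) (L := L) ρ hL hρ hβ hv D

/-! ## §2 The two-sided PTBC swap law -/

/-- **PTBC SWAP CEILING FROM THE DEFECT SPECIFIC-HEAT FLOOR** (`L ≥ 2`, `|β| ≤ B`, `−B ≤ u ≤ u' ≤ B`):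
`swapAcc (−S_D) ν_β u u' ≤ exp(−e^{−8N(d−1)B}·(#D/(8d(d−1)+1))·Var_Haar(Re tr ρ)·(u'−u)²/4)` — lean-1's
`defect_variance_floor` in the abstract floor form `swapAcc_le_exp_neg_floor`. [ours] -/
theorem defect_swapAcc_le (hL : 2 ≤ L) (hρ : Continuous ρ) {β B u u' : ℝ} (hβ : |β| ≤ B)
    (hu : -B ≤ u) (huu' : u ≤ u') (hu' : u' ≤ B) (D : Finset (Plaquette d L)) :
    swapAcc (fun U : GaugeConfig d L G =>
        -(∑ p ∈ D, ((N : ℝ) - (ρ (plaquetteHolonomy U p.1 p.2.1.1 p.2.1.2)).trace.re)))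
      ((Measure.pi fun _ : Edge d L => haarProbability G).tilted fun U =>
        -(β * ∑ p ∈ Dᶜ, ((N : ℝ) - (ρ (plaquetteHolonomy U p.1 p.2.1.1 p.2.1.2)).trace.re))) u u' ≤
    exp (-(Real.exp (-(8 * N * ((d - 1 : ℕ) : ℝ) * B)) * ((D.card : ℝ) / ((8 * d * (d - 1) + 1 : ℕ) : ℝ))
        * variance (fun g : G => (ρ g).trace.re) (haarProbability G) * (u' - u) ^ 2 / 4)) := by
  haveI := isProbabilityMeasure_defectBase (d := d) (L := L) ρ hρ β D
  refine swapAcc_le_exp_neg_floor (measurable_neg_defectSum ρ hρ D)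
    (neg_defectSum_bounded ρ hρ D) huu' fun v hv => ?_
  have hvB : |v| ≤ B := abs_le.2 ⟨by linarith [hv.1], by linarith [hv.2]⟩
  exact defect_floor_family ρ hL hρ hβ hvB D

/-- **The trivial defect specific-heat ceiling `Var(S_D) ≤ (N·#D)²` under every `μ_{β,u}`**. [folklore] -/
theorem defect_variance_le_sq (hρ : Continuous ρ) (β u : ℝ) (D : Finset (Plaquette d L)) :
    variance (fun U : GaugeConfig d L G =>
        ∑ p ∈ D, ((N : ℝ) - (ρ (plaquetteHolonomy U p.1 p.2.1.1 p.2.1.2)).trace.re))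
      ((Measure.pi fun _ : Edge d L => haarProbability G).tilted fun U =>
        -(β * (∑ p ∈ Dᶜ, ((N : ℝ) - (ρ (plaquetteHolonomy U p.1 p.2.1.1 p.2.1.2)).trace.re))
          + u * (∑ p ∈ D, ((N : ℝ) - (ρ (plaquetteHolonomy U p.1 p.2.1.1 p.2.1.2)).trace.re)))) ≤
      ((N : ℝ) * D.card) ^ 2 := by
  haveI := isProbabilityMeasure_defectBase (d := d) (L := L) ρ hρ β D
  haveI : IsProbabilityMeasure ((Measure.pi fun _ : Edge d L => haarProbability G).tilted fun U =>
      -(β * (∑ p ∈ Dᶜ, ((N : ℝ) - (ρ (plaquetteHolonomy U p.1 p.2.1.1 p.2.1.2)).trace.re))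
        + u * (∑ p ∈ D, ((N : ℝ) - (ρ (plaquetteHolonomy U p.1 p.2.1.1 p.2.1.2)).trace.re)))) := by
    rw [← defect_family_eq ρ hρ β u D]
    exact isProbabilityMeasure_tilted_mul (measurable_neg_defectSum ρ hρ D)
      (neg_defectSum_bounded ρ hρ D) u
  have h := variance_le_sq_of_bounded (a := 0) (b := 2 * N * D.card)
    (X := fun U : GaugeConfig d L G =>
      ∑ p ∈ D, ((N : ℝ) - (ρ (plaquetteHolonomy U p.1 p.2.1.1 p.2.1.2)).trace.re))
    (μ := (Measure.pi fun _ : Edge d L => haarProbability G).tilted fun U =>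
      -(β * (∑ p ∈ Dᶜ, ((N : ℝ) - (ρ (plaquetteHolonomy U p.1 p.2.1.1 p.2.1.2)).trace.re))
        + u * (∑ p ∈ D, ((N : ℝ) - (ρ (plaquetteHolonomy U p.1 p.2.1.1 p.2.1.2)).trace.re))))
    (ae_of_all _ fun U => defectSum_mem_Icc ρ hρ D U)
    (continuous_defectSum ρ hρ D).measurable.aemeasurable
  calc _ ≤ ((2 * (N : ℝ) * D.card - 0) / 2) ^ 2 := h
    _ = ((N : ℝ) * D.card) ^ 2 := by ring

/-- The trivial ceiling in the family spelling: `Var[−S_D ; ν_β.tilted(v·(−S_D))] ≤ (N#D)²`. [folklore] -/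
theorem defect_ceiling_family (hρ : Continuous ρ) (β v : ℝ) (D : Finset (Plaquette d L)) :
    variance (fun U : GaugeConfig d L G =>
          -(∑ p ∈ D, ((N : ℝ) - (ρ (plaquetteHolonomy U p.1 p.2.1.1 p.2.1.2)).trace.re)))
        (((Measure.pi fun _ : Edge d L => haarProbability G).tilted fun U =>
          -(β * ∑ p ∈ Dᶜ, ((N : ℝ) - (ρ (plaquetteHolonomy U p.1 p.2.1.1 p.2.1.2)).trace.re))).tilted
          fun U => v * (-(∑ p ∈ D, ((N : ℝ) - (ρ (plaquetteHolonomy U p.1 p.2.1.1 p.2.1.2)).trace.re)))) ≤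
      ((N : ℝ) * D.card) ^ 2 := by
  rw [defect_family_eq ρ hρ β v D, variance_fun_neg]
  exact defect_variance_le_sq ρ hρ β v D

/-- **PTBC SWAP FLOOR FROM THE TRIVIAL CEILING** (`u ≤ u'`):
`swapAcc (−S_D) ν_β u u' ≥ exp(−((u'−u)·√(2(N#D)²) + (N#D)²(u'−u)²))`. [ours] -/
theorem defect_swapAcc_ge (hρ : Continuous ρ) (β : ℝ) {u u' : ℝ} (huu' : u ≤ u')
    (D : Finset (Plaquette d L)) :
    exp (-((u' - u) * sqrt (2 * ((N : ℝ) * D.card) ^ 2) + ((N : ℝ) * D.card) ^ 2 * (u' - u) ^ 2)) ≤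
    swapAcc (fun U : GaugeConfig d L G =>
        -(∑ p ∈ D, ((N : ℝ) - (ρ (plaquetteHolonomy U p.1 p.2.1.1 p.2.1.2)).trace.re)))
      ((Measure.pi fun _ : Edge d L => haarProbability G).tilted fun U =>
        -(β * ∑ p ∈ Dᶜ, ((N : ℝ) - (ρ (plaquetteHolonomy U p.1 p.2.1.1 p.2.1.2)).trace.re))) u u' := by
  haveI := isProbabilityMeasure_defectBase (d := d) (L := L) ρ hρ β D
  exact swapAcc_ge_exp_neg_ceiling (measurable_neg_defectSum ρ hρ D)
    (neg_defectSum_bounded ρ hρ D) huu' fun v _ => defect_ceiling_family ρ hρ β v D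

/-! ## §3 The PTBC replica-ladder law -/

/-- **PTBC: `Ω(√#D)` REPLICAS ARE NECESSARY — every compact gauge group, every bulk coupling, every
volume `L ≥ 2`.**  A monotone defect-coupling ladder `c` inside `[−B, B]` (`|β| ≤ B`) with all adjacent
swap rates `≥ α > 0` satisfies
`e^{−8N(d−1)B}·(#D/(8d(d−1)+1))·Var_Haar(Re tr ρ)·(c_K − c_0)² ≤ 4K²·log(1/α)`. [ours] -/
theorem defect_ladder_necessary (hL : 2 ≤ L) (hρ : Continuous ρ) {β B : ℝ} (hβ : |β| ≤ B)
    (D : Finset (Plaquette d L)) (K : ℕ) (c : ℕ → ℝ) (hc : Monotone c) (hlo : -B ≤ c 0)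
    (hhi : c K ≤ B) {α : ℝ} (hα : 0 < α)
    (hacc : ∀ j < K, α ≤ swapAcc (fun U : GaugeConfig d L G =>
        -(∑ p ∈ D, ((N : ℝ) - (ρ (plaquetteHolonomy U p.1 p.2.1.1 p.2.1.2)).trace.re)))
      ((Measure.pi fun _ : Edge d L => haarProbability G).tilted fun U =>
        -(β * ∑ p ∈ Dᶜ, ((N : ℝ) - (ρ (plaquetteHolonomy U p.1 p.2.1.1 p.2.1.2)).trace.re)))
      (c j) (c (j + 1))) :
    Real.exp (-(8 * N * ((d - 1 : ℕ) : ℝ) * B)) * ((D.card : ℝ) / ((8 * d * (d - 1) + 1 : ℕ) : ℝ))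
        * variance (fun g : G => (ρ g).trace.re) (haarProbability G) * (c K - c 0) ^ 2 ≤
      4 * (K : ℝ) ^ 2 * log (1 / α) := by
  haveI := isProbabilityMeasure_defectBase (d := d) (L := L) ρ hρ β D
  have hv : 0 ≤ variance (fun g : G => (ρ g).trace.re) (haarProbability G) := variance_nonneg _ _
  refine ladder_necessary (measurable_neg_defectSum ρ hρ D) (neg_defectSum_bounded ρ hρ D)
    (by positivity) K c hc (fun v hv' => ?_) hα hacc
  have hvB : |v| ≤ B :=
    abs_le.2 ⟨by linarith [hv'.1, hc (Nat.zero_le K)], by linarith [hv'.2]⟩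
  exact defect_floor_family ρ hL hρ hβ hvB D

/-- **PTBC: `O(#D)` UNIFORM REPLICAS ALWAYS SUFFICE**: the uniform defect-coupling ladder `a + jδ` with
`δ·N·#D ≤ 1` and `3δ·N·#D ≤ log(1/α)` has every adjacent swap rate `≥ α` (trivial ceiling `(N#D)²`);
`⌈(c_K − c_0)·N·#D·max(1, 3/log(1/α))⌉` replicas. [ours] -/
theorem defect_ladder_sufficient (hρ : Continuous ρ) (β : ℝ) (D : Finset (Plaquette d L)) {a δ α : ℝ}
    (hδ : 0 ≤ δ) {K : ℕ} (hu1 : δ * ((N : ℝ) * D.card) ≤ 1)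
    (hu2 : 3 * (δ * ((N : ℝ) * D.card)) ≤ log (1 / α)) (hα : 0 < α) :
    ∀ j < K, α ≤ swapAcc (fun U : GaugeConfig d L G =>
        -(∑ p ∈ D, ((N : ℝ) - (ρ (plaquetteHolonomy U p.1 p.2.1.1 p.2.1.2)).trace.re)))
      ((Measure.pi fun _ : Edge d L => haarProbability G).tilted fun U =>
        -(β * ∑ p ∈ Dᶜ, ((N : ℝ) - (ρ (plaquetteHolonomy U p.1 p.2.1.1 p.2.1.2)).trace.re)))
      (a + j * δ) (a + (j + 1) * δ) := by
  haveI := isProbabilityMeasure_defectBase (d := d) (L := L) ρ hρ β D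
  have hP : 0 ≤ (N : ℝ) * D.card := by positivity
  have hs : sqrt (((N : ℝ) * D.card) ^ 2) = (N : ℝ) * D.card := sqrt_sq hP
  refine ladder_sufficient' (measurable_neg_defectSum ρ hρ D) (neg_defectSum_bounded ρ hρ D)
    hδ (sq_nonneg ((N : ℝ) * D.card)) (K := K) (fun v _ => defect_ceiling_family ρ hρ β v D) ?_ ?_ hα
  · rwa [hs]
  · rwa [hs]

end Defect

end Summit.Ventures.LatticeQCDFlow.Scaling

end
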